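import Mathlib
import Summits.Ventures.PercRepro2.Defs
import Summits.Ventures.PercRepro2.Harris
import Summits.Ventures.PercRepro2.Graph
import Summits.Ventures.PercRepro2.Events
import Summits.Ventures.PercRepro2.R21PairFrame

/-!
# The (Ψ) trilinear form and its antipodal coefficients — definitions (PercRepro2, p2)

The (Ψ)-slack of the (PM⁺) line (PsiBernstein.lean; roots `s, t`, `Q = {s ↮ t}`, `H = C_s`,
`L = C_t`, up-set `𝓤`),

  `Σ_𝓤(p) = Ug·((q − aH)·oL + q·(oLH + oHH) − aH·oH) − oLU·q²`

in the eight `Q`-intersected masses, is the diagonal `Σ_𝓤(p) = Φ(p, p, p)` of the TRILINEAR form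
`Φ(p, p', p'') = Ug(p)·((q(p') − aH(p'))·oL(p'') + q(p')·(oLH(p'') + oHH(p'')) − aH(p')·oH(p''))
− oLU(p)·q(p')·q(p'')` (`psiTri`).  Along one edge every mass is affine in the weight
(`prob_eq_pin`), so `Φ` has the trilinear Bernstein expansion `psiTri_bernstein` (eight terms).
For a set `F` of edges and a TYPE `τ : E → Bool` (`τ e = true`: exactly one of the three copies
has `e` open, `τ e = false`: exactly one has `e` closed) the **antipodal coefficient** is

  `M_{F,τ}(p) = ∑_{c : E → Fin 3} Φ(p[F ↦ c, 0], p[F ↦ c, 1], p[F ↦ c, 2])`   (`psiAnti`),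

where `p[F ↦ c, i]` (`pinTri p F τ c i`) pins the edge `e ∈ F` in copy `i` to `1` iff `c e = i`
(type `true`) / to `0` iff `c e = i` (type `false`) — the sum over all `c : E → Fin 3` counts
every distinct triple `3^{|E ∖ F|}` times, a harmless positive factor.  Up to that factor
`M_{F,τ}` at a point mass `p` is the tensor-Bernstein coefficient of `Σ_𝓤` with index `k_e = 1`
(`τ e`), `2` (`¬τ e`) on `F` and `0 / 3` (the pins of `p`) off `F`.  The one-edge expansion of
`M_{F,τ}` and the frame **(BERN-Ψ-ALL) ⟹ (Ψ)** are in PsiBernAll.lean.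

* `pinTri` — the pinned weight vector of copy `i`, and its update / insert lemmas;
* `psiTri`, `psiTri_bernstein` — the trilinear form and its one-edge expansion;
* `psiAnti`, `psiAnti_update_of_mem`, `psiAnti_update_tau_of_notMem`, `psiAnti_empty` — the
  antipodal coefficients; `cycAt` — the cyclic shift of one coordinate of `E → Fin 3`.
-/

namespace Summit.Ventures.PercRepro2

section PsiBernAllDefs

variable {V : Type*} {E : Type*} [Fintype E] [DecidableEq E]
  {R : Type*} [CommRing R] [LinearOrder R] [IsStrictOrderedRing R]

/-- The pinned weight vector of copy `i`: on `e ∈ F` of type `τ e = true` the weight is `1` iff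
`c e = i` (else `0`); of type `τ e = false` it is `0` iff `c e = i` (else `1`); off `F` it is `p`. -/
def pinTri (p : E → R) (F : Finset E) (τ : E → Bool) (c : E → Fin 3) (i : Fin 3) : E → R :=
  fun e => if e ∈ F then (if τ e then (if c e = i then 1 else 0) else (if c e = i then 0 else 1))
    else p e

omit [Fintype E] [LinearOrder R] [IsStrictOrderedRing R] in
/-- Off `F` the pinned vector agrees with `p`. -/
lemma pinTri_apply_of_notMem (p : E → R) (F : Finset E) (τ : E → Bool) (c : E → Fin 3) (i : Fin 3)
    {e : E} (he : e ∉ F) : pinTri p F τ c i e = p e := by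
  simp [pinTri, he]

omit [Fintype E] [LinearOrder R] [IsStrictOrderedRing R] in
/-- Updating an edge outside `F` commutes with pinning. -/
lemma pinTri_update_of_notMem (p : E → R) (F : Finset E) (τ : E → Bool) (c : E → Fin 3) (i : Fin 3)
    {g : E} (hg : g ∉ F) (x : R) :
    pinTri (Function.update p g x) F τ c i = Function.update (pinTri p F τ c i) g x := by
  funext e
  by_cases he : e = g
  · subst he
    simp [pinTri, hg]
  · simp [pinTri, Function.update_of_ne he]

omit [Fintype E] [LinearOrder R] [IsStrictOrderedRing R] in
/-- Updating an edge inside `F` is invisible after pinning. -/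
lemma pinTri_update_of_mem (p : E → R) (F : Finset E) (τ : E → Bool) (c : E → Fin 3) (i : Fin 3)
    {g : E} (hg : g ∈ F) (x : R) : pinTri (Function.update p g x) F τ c i = pinTri p F τ c i := by
  funext e
  by_cases he : e = g
  · subst he
    simp [pinTri, hg]
  · simp [pinTri, Function.update_of_ne he]

omit [Fintype E] [LinearOrder R] [IsStrictOrderedRing R] in
/-- Pinning on `insert g F` is pinning on `F` followed by pinning `g`. -/
lemma pinTri_insert (p : E → R) (F : Finset E) (τ : E → Bool) (c : E → Fin 3) (i : Fin 3) (g : E) :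
    pinTri p (insert g F) τ c i = Function.update (pinTri p F τ c i) g
      (if τ g then (if c g = i then 1 else 0) else (if c g = i then 0 else 1)) := by
  funext e
  by_cases he : e = g
  · subst he
    simp [pinTri]
  · simp [pinTri, he]

omit [Fintype E] [LinearOrder R] [IsStrictOrderedRing R] in
/-- The values of `τ` and `c` at an edge outside `F` are irrelevant. -/
lemma pinTri_update_tc_of_notMem (p : E → R) (F : Finset E) (τ : E → Bool) (c : E → Fin 3)
    (i : Fin 3) {g : E} (hg : g ∉ F) (b : Bool) (v : Fin 3) :
    pinTri p F (Function.update τ g b) (Function.update c g v) i = pinTri p F τ c i := by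
  funext e
  by_cases he : e = g
  · subst he
    simp [pinTri, hg]
  · simp [pinTri, Function.update_of_ne he]

/-- **The (Ψ) trilinear form** `Φ(p, p', p'')`; its diagonal `Φ(p, p, p)` is the (Ψ)-slack. -/
noncomputable def psiTri (ends : E → Sym2 V) (s t o u : V) (𝓤 : Set (Set V)) (p p' p'' : E → R) : R :=
  prob p (clusterInEvent ends s 𝓤 ∩ (connEvent ends s t)ᶜ) *
      ((prob p' (connEvent ends s t)ᶜ - prob p' (connEvent ends s u ∩ (connEvent ends s t)ᶜ)) *
          prob p'' (clusterInEvent ends t {W : Set V | o ∈ W} ∩ (connEvent ends s t)ᶜ) +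
        prob p' (connEvent ends s t)ᶜ *
          (prob p'' (connEvent ends s u ∩ clusterInEvent ends t {W : Set V | o ∈ W} ∩
              (connEvent ends s t)ᶜ) +
            prob p'' (connEvent ends s u ∩ clusterInEvent ends s {W : Set V | o ∈ W} ∩
              (connEvent ends s t)ᶜ)) -
        prob p' (connEvent ends s u ∩ (connEvent ends s t)ᶜ) *
          prob p'' (clusterInEvent ends s {W : Set V | o ∈ W} ∩ (connEvent ends s t)ᶜ)) -
    prob p (clusterInEvent ends s 𝓤 ∩ clusterInEvent ends t {W : Set V | o ∈ W} ∩
        (connEvent ends s t)ᶜ) * prob p' (connEvent ends s t)ᶜ * prob p'' (connEvent ends s t)ᶜ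

omit [LinearOrder R] [IsStrictOrderedRing R] in
/-- **The trilinear Bernstein expansion along one edge** `g` (eight terms). -/
lemma psiTri_bernstein (ends : E → Sym2 V) (s t o u : V) (𝓤 : Set (Set V)) (p p' p'' : E → R)
    (g : E) :
    psiTri ends s t o u 𝓤 p p' p'' =
      (1 - p g) * (1 - p' g) * (1 - p'' g) * psiTri ends s t o u 𝓤 (Function.update p g 0)
          (Function.update p' g 0) (Function.update p'' g 0) +
        p g * (1 - p' g) * (1 - p'' g) * psiTri ends s t o u 𝓤 (Function.update p g 1)
          (Function.update p' g 0) (Function.update p'' g 0) +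
        (1 - p g) * p' g * (1 - p'' g) * psiTri ends s t o u 𝓤 (Function.update p g 0)
          (Function.update p' g 1) (Function.update p'' g 0) +
        (1 - p g) * (1 - p' g) * p'' g * psiTri ends s t o u 𝓤 (Function.update p g 0)
          (Function.update p' g 0) (Function.update p'' g 1) +
        (1 - p g) * p' g * p'' g * psiTri ends s t o u 𝓤 (Function.update p g 0)
          (Function.update p' g 1) (Function.update p'' g 1) +
        p g * (1 - p' g) * p'' g * psiTri ends s t o u 𝓤 (Function.update p g 1)
          (Function.update p' g 0) (Function.update p'' g 1) +
        p g * p' g * (1 - p'' g) * psiTri ends s t o u 𝓤 (Function.update p g 1)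
          (Function.update p' g 1) (Function.update p'' g 0) +
        p g * p' g * p'' g * psiTri ends s t o u 𝓤 (Function.update p g 1)
          (Function.update p' g 1) (Function.update p'' g 1) := by
  unfold psiTri
  rw [prob_eq_pin p (clusterInEvent ends s 𝓤 ∩ (connEvent ends s t)ᶜ) g,
    prob_eq_pin p (clusterInEvent ends s 𝓤 ∩ clusterInEvent ends t {W : Set V | o ∈ W} ∩
      (connEvent ends s t)ᶜ) g,
    prob_eq_pin p' (connEvent ends s t)ᶜ g,
    prob_eq_pin p' (connEvent ends s u ∩ (connEvent ends s t)ᶜ) g,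
    prob_eq_pin p'' (clusterInEvent ends t {W : Set V | o ∈ W} ∩ (connEvent ends s t)ᶜ) g,
    prob_eq_pin p'' (connEvent ends s u ∩ clusterInEvent ends t {W : Set V | o ∈ W} ∩
      (connEvent ends s t)ᶜ) g,
    prob_eq_pin p'' (connEvent ends s u ∩ clusterInEvent ends s {W : Set V | o ∈ W} ∩
      (connEvent ends s t)ᶜ) g,
    prob_eq_pin p'' (clusterInEvent ends s {W : Set V | o ∈ W} ∩ (connEvent ends s t)ᶜ) g,
    prob_eq_pin p'' (connEvent ends s t)ᶜ g]
  ring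

/-- **The antipodal coefficient** `M_{F,τ}(p) = ∑_{c : E → Fin 3} Φ(p[F ↦ c, 0], p[F ↦ c, 1], p[F ↦ c, 2])`. -/
noncomputable def psiAnti (ends : E → Sym2 V) (s t o u : V) (𝓤 : Set (Set V)) (p : E → R)
    (F : Finset E) (τ : E → Bool) : R :=
  ∑ c : E → Fin 3, psiTri ends s t o u 𝓤 (pinTri p F τ c 0) (pinTri p F τ c 1) (pinTri p F τ c 2)

omit [LinearOrder R] [IsStrictOrderedRing R] in
/-- `M_{F,τ}` does not see the weight of an edge of `F`. -/
lemma psiAnti_update_of_mem (ends : E → Sym2 V) (s t o u : V) (𝓤 : Set (Set V)) (p : E → R)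
    {F : Finset E} (τ : E → Bool) {g : E} (hg : g ∈ F) (x : R) :
    psiAnti ends s t o u 𝓤 (Function.update p g x) F τ = psiAnti ends s t o u 𝓤 p F τ := by
  unfold psiAnti
  simp only [pinTri_update_of_mem p F τ _ _ hg x]

omit [LinearOrder R] [IsStrictOrderedRing R] in
/-- `M_{F,τ}` does not see the type of an edge outside `F`. -/
lemma psiAnti_update_tau_of_notMem (ends : E → Sym2 V) (s t o u : V) (𝓤 : Set (Set V))
    (p : E → R) {F : Finset E} (τ : E → Bool) {g : E} (hg : g ∉ F) (b : Bool) :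
    psiAnti ends s t o u 𝓤 p F (Function.update τ g b) = psiAnti ends s t o u 𝓤 p F τ := by
  unfold psiAnti
  refine Finset.sum_congr rfl fun c _ => ?_
  have h : ∀ i : Fin 3, pinTri p F (Function.update τ g b) c i = pinTri p F τ c i := fun i => by
    have := pinTri_update_tc_of_notMem p F τ c i hg b (c g)
    rwa [Function.update_eq_self] at this
  rw [h 0, h 1, h 2]

omit [LinearOrder R] [IsStrictOrderedRing R] in
/-- `M_{∅,τ}(p) = 3^{|E|}·Σ_𝓤(p)`. -/
lemma psiAnti_empty (ends : E → Sym2 V) (s t o u : V) (𝓤 : Set (Set V)) (p : E → R) (τ : E → Bool) :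
    psiAnti ends s t o u 𝓤 p ∅ τ =
      (Fintype.card (E → Fin 3) : R) * psiTri ends s t o u 𝓤 p p p := by
  unfold psiAnti
  have h : ∀ (c : E → Fin 3) (i : Fin 3), pinTri p ∅ τ c i = p := fun c i => by
    funext e
    simp [pinTri]
  simp only [h, Finset.sum_const, Finset.card_univ, nsmul_eq_mul]

/-- The cyclic shift of the value at `g` on `E → Fin 3`. -/
def cycAt (g : E) : (E → Fin 3) ≃ (E → Fin 3) where
  toFun c := Function.update c g (c g + 1)
  invFun c := Function.update c g (c g + 2)
  left_inv c := by
    simp only [Function.update_self, Function.update_idem]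
    have h : ∀ x : Fin 3, x + 1 + 2 = x := by decide
    rw [h, Function.update_eq_self]
  right_inv c := by
    simp only [Function.update_self, Function.update_idem]
    have h : ∀ x : Fin 3, x + 2 + 1 = x := by decide
    rw [h, Function.update_eq_self]

end PsiBernAllDefs

end Summit.Ventures.PercRepro2
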